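import Literature.NumberTheory.GaloisRepresentations.RelativeCorestrictionNaturality
import HarnessLib

/-!
# The relative corestriction `cor_{V/V'} : H^q(V', M) → H^q(V, M')` is natural in morphisms of coefficients that are
# equivariant for the BIG subgroup `V` only (not for the ambient group), all degrees

Topic `NumberTheory/GaloisRepresentations`; namespace `Literature.NumberTheory.GaloisRepresentations`. THEOREMS
ONLY (no definition, no named fact, no instance, no `sorry`). Sequel of `RelativeCorestrictionNaturality.lean`
(`relCor_cohomologyMap`: naturality in morphisms `f : M → M'` of discrete `Γ`-modules). Here the morphism is only
required to be `V`-equivariant: a pair `g' : M|_{V'} → M'|_{V'}`, `g : M|_V → M'|_V` of morphisms of the RESTRICTED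
modules with the same underlying map. This is the generality needed for TWISTS: for two characters `θ, θ'` of `Γ`
that agree on `V` (e.g. `θ' = θ·η` with `η ≡ 1` on `V = Gal(K̄/K_n)` modulo `p^k`), the identity of `M` is a
`V`-isomorphism `M(θ)|_V ≅ M(θ')|_V` but not a `Γ`-morphism, and the corestrictions of the tower must commute with it
(Rubin, *Euler Systems* VI §6.1–6.2, twisting by characters of `Gal(K_∞/K)`; used by the INPUTS hand
`bsd-inputs-honda-p1` g23 for crux L `SmallImageLowerHalfBothSigns`, line `rtt_w3`, row «D-tw-coh»).

SETTING. `Γ` profinite, `V' ≤ V ≤ Γ` closed subgroups with `[V : V']` finite, `ρ`, `ω` discrete `Γ`-modules on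
`M`, `M'`. STATEMENTS (Neukirch–Schmidt–Wingberg I §5 Prop. 1.5.2: `cor` is natural in morphisms of `V`-modules —
the corestriction `H^q(V', ·) → H^q(V, ·)` only sees the `V`-module structure; Serre I §2.5):
* `toSubgroupOf_cohomologyMap_of` — the tautological comparison `H^q(V', M) → H^q(V'.subgroupOf V, M)` intertwines
  `H^q(g')` and `H^q(g|)` (both composites are the map of the pair `(V'.subgroupOf V ≅ V', g')`);
* `relCor_cohomologyMap_of` — **`relCor (H^q(g') z) = H^q(g) (relCor z)`**, every `q` (the `cor` half is the tree's
  all-degree `cor_cohomologyMap_all` for the profinite group `↥V`).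

## References
* [NeukirchSchmidtWingberg2008] J. Neukirch, A. Schmidt, K. Wingberg, *Cohomology of Number Fields* (2008), I §5 Prop. 1.5.2.
* [SerreGaloisCohomology1997] J.-P. Serre, *Galois Cohomology* (1997), I §2.5.
* [Rubin2000] K. Rubin, *Euler Systems* (2000), Ch. VI §6.1–6.2 (twisting along the cyclotomic/`ℤ_p^d` tower).
-/

noncomputable section

open CategoryTheory Function

universe u

namespace Literature.NumberTheory.GaloisRepresentations

open _root_.TopRep _root_.ContRepresentation _root_.ContinuousCohomology

section RelCorNatRestricted

variable {Γ : Type u} [Group Γ] [TopologicalSpace Γ] [IsTopologicalGroup Γ]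
variable (V V' : Subgroup Γ)
variable {M M' : Type u} [AddCommGroup M] [TopologicalSpace M] [DiscreteTopology M]
  [AddCommGroup M'] [TopologicalSpace M'] [DiscreteTopology M']
variable (ρ : ContinuousRep Γ ℤ M) (ω : ContinuousRep Γ ℤ M')

-- No `local instance` attributes in this file (the profinite instances on `↥V` are introduced by `haveI` inside the one proof that
-- needs them), so that the statements carry exactly the binders of the tree's `relCor`.

/-- **The tautological comparison `H^q(V', M) → H^q(V'.subgroupOf V, M)` intertwines `H^q(g')` and `H^q(g|)`** for a
`V'`-morphism `g'` and a `V`-morphism `g` with the same underlying map (both composites are the map of the pair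
`(V'.subgroupOf V ≅ V', g')`). [cite: SerreGaloisCohomology1997, I §2.5] [cite: NeukirchSchmidtWingberg2008, I §5 Prop. 1.5.2] -/
theorem toSubgroupOf_cohomologyMap_of (h : V' ≤ V) (q : ℕ)
    (g' : (ρ.restrict (subgroupIncl V')).toTopRep ⟶ (ω.restrict (subgroupIncl V')).toTopRep)
    (g : (ρ.restrict (subgroupIncl V)).toTopRep ⟶ (ω.restrict (subgroupIncl V)).toTopRep)
    (hg : ∀ v, g'.hom v = g.hom v)
    (z : continuousCohomology q (ρ.restrict (subgroupIncl V')).toTopRep) :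
    toSubgroupOf ω.toTopRep h q (cohomologyMap g' q z) =
      cohomologyMap (resModHom (V'.subgroupOf V) g) q (toSubgroupOf ρ.toTopRep h q z) := by
  let F : TopRep.res ((subgroupOfHom h : (V'.subgroupOf V : Subgroup V) →ₜ* V') :
        (V'.subgroupOf V : Subgroup V) →* V') (ρ.restrict (subgroupIncl V')).toTopRep ⟶ (repSub V V' ω).toTopRep :=
    TopRep.ofHom ⟨g'.hom.toContinuousLinearMap, fun s ↦ g'.hom.isIntertwining' (subgroupOfHom h s)⟩
  have h1 : toSubgroupOf ω.toTopRep h q (cohomologyMap g' q z) =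
      ContinuousCohomology.map (subgroupOfHom h) F q z :=
    (map_comp_apply_of (X := (ρ.restrict (subgroupIncl V')).toTopRep) (Y := (ω.restrict (subgroupIncl V')).toTopRep)
      (Z := (repSub V V' ω).toTopRep) (ContinuousMonoidHom.id V') (subgroupOfHom h) (subgroupOfHom h)
      (fun _ ↦ rfl) (resIdHom g')
      (TopRep.ofHom ⟨ContinuousLinearMap.id ℤ M', fun _ ↦ rfl⟩) F (fun _ ↦ rfl) q z).symm
  have h2 : cohomologyMap (resModHom (V'.subgroupOf V) g) q (toSubgroupOf ρ.toTopRep h q z) =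
      ContinuousCohomology.map (subgroupOfHom h) F q z :=
    (map_comp_apply_of (X := (ρ.restrict (subgroupIncl V')).toTopRep) (Y := (repSub V V' ρ).toTopRep)
      (Z := (repSub V V' ω).toTopRep) (subgroupOfHom h) (ContinuousMonoidHom.id _) (subgroupOfHom h)
      (fun _ ↦ rfl) (TopRep.ofHom ⟨ContinuousLinearMap.id ℤ M, fun _ ↦ rfl⟩)
      (resIdHom (resModHom (V'.subgroupOf V) g)) F (fun v ↦ hg v) q z).symm
  rw [h1, h2]

variable [CompactSpace Γ] [T2Space Γ] [TotallyDisconnectedSpace Γ] [hV : IsClosed (V : Set Γ)] [hV' : IsClosed (V' : Set Γ)]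
  [Fintype (V ⧸ V'.subgroupOf V)]

/-- **MAIN STATEMENT — `relCor (H^q(g') z) = H^q(g) (relCor z)`** for a `V'`-morphism `g' : M|_{V'} → M'|_{V'}` and a
`V`-morphism `g : M|_V → M'|_V` with the same underlying map: the relative corestriction `H^q(V', M) → H^q(V, M')`
along closed subgroups `V' ≤ V` of a profinite group, `[V : V']` finite, only sees the `V`-module structure — so the
corestrictions of a tower commute with the TWIST by a character trivial on `V` (identity on vectors).
[cite: NeukirchSchmidtWingberg2008, I §5 Prop. 1.5.2] [cite: SerreGaloisCohomology1997, I §2.5] [cite: Rubin2000, Ch. VI §6.1–6.2] -/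
theorem relCor_cohomologyMap_of (h : V' ≤ V) (q : ℕ)
    (g' : (ρ.restrict (subgroupIncl V')).toTopRep ⟶ (ω.restrict (subgroupIncl V')).toTopRep)
    (g : (ρ.restrict (subgroupIncl V)).toTopRep ⟶ (ω.restrict (subgroupIncl V)).toTopRep)
    (hg : ∀ v, g'.hom v = g.hom v)
    (z : continuousCohomology q (ρ.restrict (subgroupIncl V')).toTopRep) :
    relCor V V' ω h q (cohomologyMap g' q z) = cohomologyMap g q (relCor V V' ρ h q z) := by
  haveI : CompactSpace V := compactSpace_of_isClosed_subgroup
  haveI : IsClosed ((V'.subgroupOf V : Subgroup V) : Set V) := isClosed_subgroupOf_of_isClosed V V'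
  rw [relCor_apply, relCor_apply, toSubgroupOf_cohomologyMap_of V V' ρ ω h q g' g hg,
    cor_cohomologyMap_all (V'.subgroupOf V) (ρ.restrict (subgroupIncl V)) (ω.restrict (subgroupIncl V)) g q]

end RelCorNatRestricted

end Literature.NumberTheory.GaloisRepresentations

end
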